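import Literature.Probability.Percolation.FullPlaneCNL
import Literature.Probability.RandomPlanarGeometry.SLEDrivingCoupling
import Mathlib.Probability.Kernel.Representation
import HarnessLib

/-!
# Presentations of a full-plane CNL law: change of probability space

Topic `Literature/Probability/Percolation` (proofs only; no definition, no named fact). The
named fact `exists_isFullPlaneCNLLaw` (Camia–Newman, CMP 268 (2006), Thms 1 and 6, in DKKMO's
coupling distance `d_CN`) asks for a presentation of the full-plane loop law on the unit
interval with Lebesgue measure, `∃ X : [0,1] → C, IsFullPlaneCNLLaw volume X`. This file proves
that the choice of the probability space is immaterial, as announced in the module docstring of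
`FullPlaneCNL.lean` ("every such measure is the image of Lebesgue measure on `[0, 1]` under a
Borel map, and couplings lift along such a map (disintegration), so presenting the law on
`unitInterval` loses nothing"):

* `cnLawEDist_comp_snd_le` — **re-presentation does not increase the coupling distance**: for a
  measurable `f : T → Ω'` and a finite measure `ν` on `T`,
  `d_CN((μ, X), (ν, X' ∘ f)) ≤ d_CN((μ, X), (f_* ν, X'))` when the first space is standard
  Borel (a coupling of `μ` and `f_* ν` is pulled back to a coupling of `μ` and `ν` along the
  transfer lemma `exists_coupling_map_snd_eq` of `SLEDrivingCoupling.lean`, Kallenberg 2002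
  Thm 6.10; the exceptional event is a preimage and outer measures only decrease,
  `Measure.le_map_apply`);
* `cnLawEDist_le_of_eqOn_snd`, `cnLawEDist_congr_of_eqOn_snd` — the coupling distance only
  depends on the presentation up to a null set;
* `IsFullPlaneCNLLaw.comp` — if `(f_* ν, X)` is a full-plane CNL law then so is `(ν, X ∘ f)`;
  `IsFullPlaneCNLLaw.congr_of_eqOn` — and so is any `ν`-a.e. modification;
* `IsFullPlaneCNLLaw.exists_unitInterval`, `exists_isFullPlaneCNLLaw_of_isFullPlaneCNLLaw` —
  **a full-plane CNL law presented on any standard Borel probability space yields the named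
  fact** `exists_isFullPlaneCNLLaw` (Mathlib's `MeasureTheory.Measure.exists_measurable_map_eq`:
  every probability measure on a standard Borel space is `f_* Leb` for a Borel `f : [0,1] → Ω'`,
  Kallenberg 2021 Lemma 4.22).

These are the last, soft step of the passage from the printed theorem (a probability measure
`P` on the Polish space `Ω` of closed sets of curves, CMP 268 Thm 6) to the `d_CN` rendering on
`[0, 1]`.

## References

* F. Camia, C. M. Newman, Comm. Math. Phys. 268 (2006) 1–38, Thms 1 and 6, §6 [CamiaNewman2006].
* H. Duminil-Copin et al., arXiv:2012.11672v2 (2026), §1.2, eq. (2) [arXiv201211672v2].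
* O. Kallenberg, *Foundations of Modern Probability*, 2nd ed. (2002), Thm 6.10; 3rd ed. (2021),
  Lemma 4.22.
-/

noncomputable section

open Set Filter MeasureTheory
open scoped Topology ENNReal unitInterval

namespace Literature.Probability.Percolation

open LatticeModels RandomPlanarGeometry

section Law

variable {E : Type*} [NormedAddCommGroup E]
variable {Ω Ω' T : Type*} [MeasurableSpace Ω] [MeasurableSpace Ω'] [MeasurableSpace T]

/-- **Re-presentation of the second law along a factor map does not increase `d_CN`**: for a
measurable `f : T → Ω'`, a finite measure `ν` on `T` and a finite measure `μ` on a standard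
Borel space, `d_CN((μ, X), (ν, X' ∘ f)) ≤ d_CN((μ, X), (f_* ν, X'))`. A coupling `P` of `μ` and
`f_* ν` with `P[d_CN(X, X') > ε] < ε` is pulled back (transfer, `exists_coupling_map_snd_eq`)
to a coupling `R` of `μ` and `ν` with `(id × f)_* R = P`, and
`R[(id × f)⁻¹ A] ≤ ((id × f)_* R)[A] = P[A]` for every event `A` (outer measure). [folklore] -/
theorem cnLawEDist_comp_snd_le [StandardBorelSpace Ω] [Nonempty Ω] (μ : Measure Ω)
    [IsFiniteMeasure μ] (X : Ω → LoopConfig E) (ν : Measure T) [IsFiniteMeasure ν]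
    {f : T → Ω'} (hf : Measurable f) (X' : Ω' → LoopConfig E) :
    LoopConfig.cnLawEDist μ X ν (X' ∘ f) ≤ LoopConfig.cnLawEDist μ X (ν.map f) X' := by
  refine le_iInf fun ε ↦ le_iInf fun hε ↦ le_iInf fun P ↦ le_iInf fun h₁ ↦ le_iInf fun h₂ ↦
    le_iInf fun hP ↦ ?_
  haveI : IsFiniteMeasure P := by
    constructor
    have e : P univ = μ univ := by
      rw [← h₁, Measure.map_apply measurable_fst MeasurableSet.univ, preimage_univ]
    rw [e]
    exact measure_lt_top μ univ
  obtain ⟨R, hR₂, hR⟩ := exists_coupling_map_snd_eq P ν hf h₂.symm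
  refine LoopConfig.cnLawEDist_le_of_coupling hε R ?_ hR₂ (lt_of_le_of_lt ?_ hP)
  · rw [← h₁, ← hR, Measure.map_map measurable_fst (measurable_id.prodMap hf)]
    rfl
  · rw [← hR]
    exact Measure.le_map_apply (measurable_id.prodMap hf).aemeasurable _

/-- **The coupling distance sees the second presentation only up to a null set**: if `X'` and
`Y'` agree on a measurable set `S` of full `μ'`-measure then
`d_CN((μ, X), (μ', Y')) ≤ d_CN((μ, X), (μ', X'))` (the same coupling works: its exceptional
event for `Y'` is contained in the one for `X'` up to `Ω × Sᶜ`, which is null for every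
coupling). [folklore] -/
theorem cnLawEDist_le_of_eqOn_snd {μ : Measure Ω} {X : Ω → LoopConfig E} {μ' : Measure Ω'}
    {X' Y' : Ω' → LoopConfig E} {S : Set Ω'} (hS : MeasurableSet S) (h0 : μ' Sᶜ = 0)
    (hXY : EqOn X' Y' S) :
    LoopConfig.cnLawEDist μ X μ' Y' ≤ LoopConfig.cnLawEDist μ X μ' X' := by
  refine le_iInf fun ε ↦ le_iInf fun hε ↦ le_iInf fun P ↦ le_iInf fun h₁ ↦ le_iInf fun h₂ ↦
    le_iInf fun hP ↦ ?_
  refine LoopConfig.cnLawEDist_le_of_coupling hε P h₁ h₂ (lt_of_le_of_lt ?_ hP)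
  have hnull : P (Prod.snd ⁻¹' Sᶜ) = 0 := by
    rw [← Measure.map_apply measurable_snd hS.compl, h₂, h0]
  calc P {p | ¬ LoopConfig.IsClose ε (X p.1) (Y' p.2)}
      ≤ P ({p | ¬ LoopConfig.IsClose ε (X p.1) (X' p.2)} ∪ Prod.snd ⁻¹' Sᶜ) := by
        refine measure_mono fun p hp ↦ ?_
        by_cases hs : p.2 ∈ S
        · left
          simp only [mem_setOf_eq] at hp ⊢
          rwa [hXY hs]
        · exact Or.inr hs
    _ ≤ P {p | ¬ LoopConfig.IsClose ε (X p.1) (X' p.2)} + P (Prod.snd ⁻¹' Sᶜ) :=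
        measure_union_le _ _
    _ = P {p | ¬ LoopConfig.IsClose ε (X p.1) (X' p.2)} := by rw [hnull, add_zero]

/-- The coupling distance is unchanged by modifying the second presentation on a null set. [folklore] -/
theorem cnLawEDist_congr_of_eqOn_snd {μ : Measure Ω} {X : Ω → LoopConfig E} {μ' : Measure Ω'}
    {X' Y' : Ω' → LoopConfig E} {S : Set Ω'} (hS : MeasurableSet S) (h0 : μ' Sᶜ = 0)
    (hXY : EqOn X' Y' S) :
    LoopConfig.cnLawEDist μ X μ' X' = LoopConfig.cnLawEDist μ X μ' Y' :=
  le_antisymm (cnLawEDist_le_of_eqOn_snd hS h0 hXY.symm) (cnLawEDist_le_of_eqOn_snd hS h0 hXY)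

end Law

/-! ### Consequences for full-plane CNL laws -/

section FullPlane

variable {Ω' T : Type*} [MeasurableSpace Ω'] [MeasurableSpace T]

/-- **Re-presentation of a full-plane CNL law**: if the law of `X` under `f_* ν` is a full-plane
CNL law (`f : T → Ω'` measurable, `ν` finite), then so is the law of `X ∘ f` under `ν`
(`cnLawEDist_comp_snd_le` with the standard Borel lattice space `SiteConfig (Site 2)`). [folklore] -/
theorem IsFullPlaneCNLLaw.comp (ν : Measure T) [IsFiniteMeasure ν] {f : T → Ω'}
    (hf : Measurable f) {X : Ω' → LoopConfig ℂ} (h : IsFullPlaneCNLLaw (ν.map f) X) :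
    IsFullPlaneCNLLaw ν (X ∘ f) := by
  haveI := standardBorelSpace_siteConfig
  exact tendsto_of_tendsto_of_tendsto_of_le_of_le tendsto_const_nhds h (fun _ ↦ bot_le)
    fun δ ↦ cnLawEDist_comp_snd_le (triSitePercolation half) (siteLoopConfig δ) ν hf X

/-- A full-plane CNL law stays one after modifying the presentation on a null set. [folklore] -/
theorem IsFullPlaneCNLLaw.congr_of_eqOn {μ : Measure Ω'} {X Y : Ω' → LoopConfig ℂ} {S : Set Ω'}
    (h : IsFullPlaneCNLLaw μ X) (hS : MeasurableSet S) (h0 : μ Sᶜ = 0) (hXY : EqOn X Y S) :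
    IsFullPlaneCNLLaw μ Y :=
  tendsto_of_tendsto_of_tendsto_of_le_of_le tendsto_const_nhds h (fun _ ↦ bot_le)
    fun _ ↦ cnLawEDist_le_of_eqOn_snd hS h0 hXY

/-- **Presentation on the unit interval.** A full-plane CNL law presented on a standard Borel
probability space `(Ω', μ)` has a presentation on `([0, 1], Leb)`: `μ = f_* Leb` for a Borel
`f : [0, 1] → Ω'` (`MeasureTheory.Measure.exists_measurable_map_eq`, Kallenberg 2021
Lemma 4.22), and `X ∘ f` presents the same law (`IsFullPlaneCNLLaw.comp`). [folklore] -/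
theorem IsFullPlaneCNLLaw.exists_unitInterval [StandardBorelSpace Ω'] [Nonempty Ω']
    {μ : Measure Ω'} [IsProbabilityMeasure μ] {X : Ω' → LoopConfig ℂ}
    (h : IsFullPlaneCNLLaw μ X) :
    ∃ Y : unitInterval → LoopConfig ℂ, IsFullPlaneCNLLaw volume Y := by
  obtain ⟨f, hf, hfμ⟩ := MeasureTheory.Measure.exists_measurable_map_eq μ
  refine ⟨X ∘ f, IsFullPlaneCNLLaw.comp volume hf ?_⟩
  rwa [hfμ]

/-- **Reduction of the named fact to any standard Borel presentation**: a full-plane CNL law on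
some standard Borel probability space gives `exists_isFullPlaneCNLLaw` (Camia–Newman, CMP 268
(2006), Thms 1 and 6, `d_CN` form on `[0, 1]`). [cite: CamiaNewman2006, Thm 1 and Thm 6] -/
theorem exists_isFullPlaneCNLLaw_of_isFullPlaneCNLLaw [StandardBorelSpace Ω'] [Nonempty Ω']
    {μ : Measure Ω'} [IsProbabilityMeasure μ] {X : Ω' → LoopConfig ℂ}
    (h : IsFullPlaneCNLLaw μ X) : exists_isFullPlaneCNLLaw :=
  h.exists_unitInterval

end FullPlane

end Literature.Probability.Percolation

end
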